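import Summits.BirchSwinnertonDyer.BirchSwinnertonDyer.Theorems.SignedLowerHalvesKobayashiLowerHalfLargeImageMuPart
import Summits.BirchSwinnertonDyer.BirchSwinnertonDyer.Theorems.KatoDescentPotSupersingularWildFineSelmerSupersingularCMAnchor
import HarnessLib

/-!
# Route `SignedLowerHalves`, crux 3 `KobayashiLowerHalfLargeImage` (item stmt-BirchSwinnertonDyer-19001):
# a by-product of the μ-part on the crux's class — Coates–Sujatha's statement (A) at `(E, p)` for EVERY curve with
# good supersingular reduction `a_p = 0` and `ρ̄_{E,p}` ONTO: at `p = 3` modulo PUBLISHED facts, at `p ≥ 5` modulo B⁰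
# (cell `bsd-ssimc`, width seat `bsd-line-slh-p1-w6` gen 0; helper file `--supports 19001`; THEOREMS ONLY; route-free)

HONEST FRAMING.  Nothing here proves crux 3 or BSD.  This file reads the μ-PART of this seat's files
(`LargeImageMuPart.mu_charGen_eq_mu_kobayashiL_of_muFloor`: `μ(ξ^ε) = μ(L_p^ε)` for both signs at an odd good supersingular
prime with `ρ̄` onto, GRANTED the published named facts `h12`, `h41`, `h5`, `h3`, `hJ`) together with the μ-FLOOR (one sign has
`μ(L_p^ε) = 0`: input-free at `p = 3`, B⁰ / one orbit-sum certificate at `p ≥ 5`) on the SIGNED SELMER GROUP: for that sign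
`μ(X^ε(E/ℚ_∞)) = 0`, hence `Sel^ε(E/ℚ_∞)[p]` is finite, hence (cell bsd-potss' bridge `Sel₀ ≤ Sel^ε`, p466275, and
`FineSelmerLeSignedSelmer.conjA_of_finite_fineSelmerInfty_pTorsion`) the Pontryagin dual of the fine Selmer group
`Sel₀(ℚ_∞, E[p^∞])` is finitely generated over `ℤ_p` — Coates–Sujatha's (A) in the tree's `∃`-form — for EVERY cyclotomic `κ`.

WHY IT IS RECORDED HERE (19001 helper): it is the algebraic μ-statement on the crux's own class (X7 ⊂ «good supersingular,
`a_p = 0`, onto»; also X6 by `ClassX6.surj`), with no rank / Ш / Tamagawa datum.  WHO ELSE READS IT: the Conj-A cell bsd-potss —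
its SUPERSINGULAR UNIT-ANCHOR road (`WildFineSelmerSupersingularUnitAnchor`, seat bsd-potss-k9-c4 g5: a congruent good-supersingular `a₃ = 0`
anchor `E′` with `rank = 0`, `#Ш[3^∞] = 1`, `3 ∤ Tam` ⟹ (A) at the row) needs NO arithmetic certificate on the anchor when
`ρ̄_{E′,3}` is onto: `finite_signedSelmerInfty_pTorsion_three` below is the anchor input verbatim.

* `exists_sign_finite_signedSelmerInfty_pTorsion_of_muFloor` — μ-floor as a hypothesis, at a normalised cyclotomic frame.
* `conjA_rat_of_muFloor`, **`conjA_rat_three`** (`p = 3`: PUBLISHED facts only), `conjA_rat_of_teichSpanGenAll` (odd `p`, B⁰ only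
  at `p ≥ 5`): (A) at `(E, p)` for every cyclotomic `κ`, for `E` with good reduction at `p`, `a_p = 0`, `ρ̄_{E,p}` onto and a
  newform (modularity binder).
* `finite_signedSelmerInfty_pTorsion_three` — the anchor-shaped statement at `3`.

CONDITIONAL on the displayed named facts; (A) is NOT asserted unconditionally; no item is closed.
References: [CoatesSujatha2005] §3 (Conjecture A); [Kobayashi2003] Def. 1.1, Thm. 1.2, Thm. 4.1, proof of Thm. 7.4 (p. 13);
[Washington1997] §13.2; [PollackWeston2011] Rem. 4.2; [Vaserstein1972SL2] Theorem; [GreenbergLNM1716] §1 p. 54.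
-/

-- D-0017: single-problem summit, the namespace repeats the problem name by design.
set_option linter.dupNamespace false
set_option autoImplicit false

noncomputable section

open scoped Classical MatrixGroups ModularForm

open CongruenceSubgroup NumberField IsDedekindDomain Field WeierstrassCurve Literature.NumberTheory.EllipticCurves
  Literature.NumberTheory.EllipticCurves.ModularForms
  Literature.NumberTheory.EllipticCurves.Kobayashi2003 Literature.NumberTheory.EllipticCurves.GreenbergVatsal2000
  Literature.NumberTheory.EllipticCurves.Rank1Residual ZpExtension
  Summit.BirchSwinnertonDyer.Rank1Residual.Supersingular

namespace Summit.BirchSwinnertonDyer.BirchSwinnertonDyer.Theorems.LargeImageMuPartConjA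

open Summit.BirchSwinnertonDyer.Rank1Residual.X1.MuLambda (mu)
open Summit.BirchSwinnertonDyer.Rank1Residual.X11a (mu_eq_zero_of_hasUnitContent)
open Summit.BirchSwinnertonDyer.BirchSwinnertonDyer.Cruxes.AnalyticMuZeroX9.TeichSpan (TeichSpanGenAll)
open Summit.BirchSwinnertonDyer.BirchSwinnertonDyer.Theorems.LargeImageMuPart
  (exists_signBlindDefect_hasUnitContent_of_muFloor mu_charGen_eq_mu_kobayashiL_of_muFloor)
open Summit.BirchSwinnertonDyer.BirchSwinnertonDyer.Theorems.WildFineSelmerSupersingularCMAnchor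
  (finite_signedSelmerInfty_pTorsion_of_isTorsion_of_muInvariant_eq_zero finite_fineSelmerInfty_pTorsion_of_kerSubgroup_eq
    exists_normalised_cyclotomic)
open Summit.BirchSwinnertonDyer.Rank1Residual.Additive (exists_finset_forall_not_mem_good)

variable {p : ℕ} [Fact p.Prime]

/-- **One sign with `Sel^ε(E/ℚ_∞)[p]` finite, from the μ-floor as a hypothesis.**  GRANTED `h12`, `h41`, `h5`, `h3`, `hJ`
(PUBLISHED) and the μ-floor `hfloor` at `(W, p)`: for `W/ℚ` globally minimal, `p` odd good, `a_p = 0`, `ρ̄_{E,p}` onto, a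
newform `f`, and a NORMALISED cyclotomic frame `(κ, γ)` (`κ γ` a topological generator that is a cyclotomic variable): for the
μ-floor sign `ε₀`, the `p`-torsion of `Sel^{ε₀}(E/ℚ_∞)` is finite (`μ(X^{ε₀}) = 0` by the μ-part, then Washington §13.2).
[cite: Kobayashi2003, Def. 1.1, Thm. 1.2] [cite: Washington1997, §13.2] -/
theorem exists_sign_finite_signedSelmerInfty_pTorsion_of_muFloor
    (h12 : Kobayashi2003.thm12_signedSelmerDual_finite_torsion)
    (h41 : Kobayashi2003.thm41_signedCharIdeal_divisibility)
    (h5 : realPeriodRat_eq_unit_mul_plusPeriod) (h3 : realPeriodRat_eq_unit_mul_plusPeriod_three)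
    (hJ : Kobayashi2003.thm62_63_73_signedColemanKato_zetaJoint)
    (W : WeierstrassCurve ℚ) [W.IsElliptic] [W.IsGloballyMinimal]
    (hfloor : ∃ ε₀ : ℤˣ, ∀ [NeZero (W.conductorNorm ℤ)] (f : CuspForm (Gamma0 (W.conductorNorm ℤ)) 2),
      IsNewformOf W f → ∀ Lplus Lminus : IwasawaAlgebra p, IsPollackPair f p Lplus Lminus →
        HasUnitContent (kobayashiL ε₀ Lplus Lminus))
    (hp2 : p ≠ 2) (hgood : W.HasGoodReductionAtPrime p) (hap : W.frobeniusTrace p = 0) (hs : Surj W p)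
    [NeZero (W.conductorNorm ℤ)] (f : CuspForm (Gamma0 (W.conductorNorm ℤ)) 2) (hf : IsNewformOf W f)
    {κ : ZpExtension ℚ p} {γ : absoluteGaloisGroup ℚ} (hκ : κ.IsCyclotomic) (hγ : κ.IsTopGenerator γ)
    (hγc : IsCyclotomicVariable p γ) :
    ∃ ε : ℤˣ, Set.Finite {s : signedSelmerInfty W κ ε | p • s = 0} := by
  obtain ⟨ε₀, hε₀⟩ := hfloor
  refine ⟨ε₀, ?_⟩
  obtain ⟨Lplus, Lminus, hPP⟩ :=
    exists_isPollackPair (pollack_exists_plusMinusPAdicLFunction_holds (W := W) (f := f) (p := p)) hp2 hf hgood hap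
  set D : Kobayashi2003.SignedSelmerDualData W κ γ ε₀ := signedSelmerDualData W κ ε₀ hγ with hD
  haveI : Module.Finite (IwasawaAlgebra p) D.X := h12.moduleFinite hp2 hgood hap hκ hγ D
  have hT : Module.IsTorsion (IwasawaAlgebra p) D.X := h12.isTorsion hp2 hgood hap hκ hγ D
  -- a generator `ξ` of `char X^{ε₀}` with `μ(ξ) = μ(L^{ε₀}) = 0`
  obtain ⟨δ, -, hδ⟩ := exists_signBlindDefect_hasUnitContent_of_muFloor h12 h41 h5 h3 hJ ⟨ε₀, hε₀⟩ hp2 hgood hap hs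
    hκ hγ hγc hf hPP
  obtain ⟨ξ, hξ, -⟩ := hδ ε₀ D
  obtain ⟨hmu, hξ0⟩ :=
    mu_charGen_eq_mu_kobayashiL_of_muFloor h12 h41 h5 h3 hJ ⟨ε₀, hε₀⟩ hp2 hgood hap hs hκ hγ hγc hf hPP ε₀ D hξ
  have hμ0 : mu ξ = 0 := by rw [hmu]; exact mu_eq_zero_of_hasUnitContent (hε₀ f hf Lplus Lminus hPP)
  have hμX : muInvariant p D.X = 0 := by
    rw [← Summit.BirchSwinnertonDyer.Rank1Residual.X1.MuPart.mu_generator_eq_muInvariant D.X hT hξ0 hξ, hμ0]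
  exact finite_signedSelmerInfty_pTorsion_of_isTorsion_of_muInvariant_eq_zero W κ ε₀ hγ hT hμX

/-- **Coates–Sujatha's (A) at `(E, p)` from the μ-floor as a hypothesis.**  Same named facts; `p` odd good, `a_p = 0`,
`ρ̄_{E,p}` onto, a newform of `W` (modularity binder): for EVERY cyclotomic `ℤ_p`-extension datum `κ`, the Pontryagin dual of
`Sel₀(ℚ_∞, W[p^∞])` is finitely generated over `ℤ_p` (the tree's `∃`-form of (A)).  Chain: μ-floor sign `ε₀`, `Sel^{ε₀}[p]`
finite at the normalised frame ⟹ `Sel₀[p]` finite there (bridge `Sel₀ ≤ Sel^ε`, bad set from `exists_finset_forall_not_mem_good`)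
⟹ at every cyclotomic `κ` (`ker κ = ker κ₀`) ⟹ (A).
[cite: CoatesSujatha2005, §3 (Conjecture A)] [cite: Kobayashi2003, Def. 1.1, Thm. 1.2] [cite: Washington1997, §13.2] -/
theorem conjA_rat_of_muFloor
    (h12 : Kobayashi2003.thm12_signedSelmerDual_finite_torsion)
    (h41 : Kobayashi2003.thm41_signedCharIdeal_divisibility)
    (h5 : realPeriodRat_eq_unit_mul_plusPeriod) (h3 : realPeriodRat_eq_unit_mul_plusPeriod_three)
    (hJ : Kobayashi2003.thm62_63_73_signedColemanKato_zetaJoint)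
    (W : WeierstrassCurve ℚ) [W.IsElliptic] [W.IsGloballyMinimal]
    (hfloor : ∃ ε₀ : ℤˣ, ∀ [NeZero (W.conductorNorm ℤ)] (f : CuspForm (Gamma0 (W.conductorNorm ℤ)) 2),
      IsNewformOf W f → ∀ Lplus Lminus : IwasawaAlgebra p, IsPollackPair f p Lplus Lminus →
        HasUnitContent (kobayashiL ε₀ Lplus Lminus))
    (hp2 : p ≠ 2) (hgood : W.HasGoodReductionAtPrime p) (hap : W.frobeniusTrace p = 0) (hs : Surj W p)
    [NeZero (W.conductorNorm ℤ)] (f : CuspForm (Gamma0 (W.conductorNorm ℤ)) 2) (hf : IsNewformOf W f) :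
    ∀ (κ : ZpExtension ℚ p), κ.IsCyclotomic →
      ∃ (γ : absoluteGaloisGroup ℚ) (D : W.FineSelmerDualData κ γ),
        Module.Finite ℤ_[p] (RestrictScalars ℤ_[p] (IwasawaAlgebra p) D.X) := by
  obtain ⟨κ₀, hκ₀, γ₀, hγ₀, hγ₀c⟩ := exists_normalised_cyclotomic p
  obtain ⟨S, hS⟩ := exists_finset_forall_not_mem_good W p
  obtain ⟨ε₀, hfin₀⟩ := exists_sign_finite_signedSelmerInfty_pTorsion_of_muFloor h12 h41 h5 h3 hJ W hfloor hp2 hgood hap hs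
    f hf hκ₀ hγ₀ hγ₀c
  have h0₀ : Set.Finite {s : W.fineSelmerInfty κ₀ | p • s = 0} :=
    FineSelmerLeSignedSelmer.finite_fineSelmerInfty_pTorsion_of_finite_signedSelmerInfty_pTorsion W κ₀ S hS ε₀ hfin₀
  intro κ hκ
  have h0 : Set.Finite {s : W.fineSelmerInfty κ | p • s = 0} :=
    finite_fineSelmerInfty_pTorsion_of_kerSubgroup_eq W (IsCyclotomic.kerSubgroup_eq hκ₀ hκ) h0₀
  obtain ⟨γ, hγ⟩ : ∃ γ : absoluteGaloisGroup ℚ, κ.IsTopGenerator γ := κ.surjective (Multiplicative.ofAdd 1)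
  exact FineSelmerLeSignedSelmer.conjA_of_finite_fineSelmerInfty_pTorsion W κ hγ h0

/-- **Coates–Sujatha's (A) at `(E, 3)` for EVERY `E/ℚ` with good supersingular reduction at `3` (`a₃ = 0`) and `ρ̄_{E,3}` ONTO,
modulo PUBLISHED named facts only** (`h12`, `h41`, `h5`, `h3`, `hJ`; the μ-floor at `3` is the tree's input-free THEOREM B road):
for every cyclotomic `κ`, the dual fine Selmer group of `E` over `ℚ_∞` is finitely generated over `ℤ₃`.  No rank / Ш / Tamagawa
datum; no CM.  (Newform `f` = modularity binder.) [cite: CoatesSujatha2005, §3 (Conjecture A)] [cite: Kobayashi2003, Thm. 1.2, Thm. 4.1]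
[cite: Vaserstein1972SL2, Theorem] [cite: PollackWeston2011, Rem. 4.2] -/
theorem conjA_rat_three
    (h12 : Kobayashi2003.thm12_signedSelmerDual_finite_torsion)
    (h41 : Kobayashi2003.thm41_signedCharIdeal_divisibility)
    (h5 : realPeriodRat_eq_unit_mul_plusPeriod) (h3 : realPeriodRat_eq_unit_mul_plusPeriod_three)
    (hJ : Kobayashi2003.thm62_63_73_signedColemanKato_zetaJoint)
    (W : WeierstrassCurve ℚ) [W.IsElliptic] [W.IsGloballyMinimal]
    (hp3 : p = 3) (hgood : W.HasGoodReductionAtPrime p) (hap : W.frobeniusTrace p = 0) (hs : Surj W p)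
    [NeZero (W.conductorNorm ℤ)] (f : CuspForm (Gamma0 (W.conductorNorm ℤ)) 2) (hf : IsNewformOf W f) :
    ∀ (κ : ZpExtension ℚ p), κ.IsCyclotomic →
      ∃ (γ : absoluteGaloisGroup ℚ) (D : W.FineSelmerDualData κ γ),
        Module.Finite ℤ_[p] (RestrictScalars ℤ_[p] (IwasawaAlgebra p) D.X) :=
  conjA_rat_of_muFloor h12 h41 h5 h3 hJ W (LargeImageMuFloor.signedMuFloor_three (W := W) p hp3 hgood hap)
    (by subst hp3; decide) hgood hap hs f hf

/-- **(A) at `(E, p)`, `p` odd, from Conjecture B⁰** (used only at `p ≥ 5`): good supersingular `a_p = 0`, `ρ̄` onto, a newform.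
[cite: CoatesSujatha2005, §3 (Conjecture A)] [cite: Kobayashi2003, Thm. 1.2, Thm. 4.1] [cite: PollackWeston2011, Rem. 4.2] -/
theorem conjA_rat_of_teichSpanGenAll
    (h12 : Kobayashi2003.thm12_signedSelmerDual_finite_torsion)
    (h41 : Kobayashi2003.thm41_signedCharIdeal_divisibility)
    (h5 : realPeriodRat_eq_unit_mul_plusPeriod) (h3 : realPeriodRat_eq_unit_mul_plusPeriod_three)
    (hJ : Kobayashi2003.thm62_63_73_signedColemanKato_zetaJoint) (hB : TeichSpanGenAll)
    (W : WeierstrassCurve ℚ) [W.IsElliptic] [W.IsGloballyMinimal]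
    (hp2 : p ≠ 2) (hgood : W.HasGoodReductionAtPrime p) (hap : W.frobeniusTrace p = 0) (hs : Surj W p)
    [NeZero (W.conductorNorm ℤ)] (f : CuspForm (Gamma0 (W.conductorNorm ℤ)) 2) (hf : IsNewformOf W f) :
    ∀ (κ : ZpExtension ℚ p), κ.IsCyclotomic →
      ∃ (γ : absoluteGaloisGroup ℚ) (D : W.FineSelmerDualData κ γ),
        Module.Finite ℤ_[p] (RestrictScalars ℤ_[p] (IwasawaAlgebra p) D.X) :=
  conjA_rat_of_muFloor h12 h41 h5 h3 hJ W (LargeImageMuFloor.signedMuFloor_of_teichSpanGenAll (W := W) hB hp2 hgood hap)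
    hp2 hgood hap hs f hf

/-- **The anchor input of cell bsd-potss' supersingular unit-anchor road, WITHOUT arithmetic certificate, at `p = 3`:** for
`E′/ℚ` globally minimal with good reduction at `3`, `a₃ = 0`, `ρ̄_{E′,3}` onto, a newform, and every normalised cyclotomic frame,
SOME sign has `Sel^ε(E′/ℚ_∞)[3]` finite — modulo PUBLISHED facts only (no `rank = 0` / `#Ш[3^∞] = 1` / `3 ∤ Tam`).
[cite: Kobayashi2003, Def. 1.1, Thm. 1.2] [cite: Washington1997, §13.2] [cite: Vaserstein1972SL2, Theorem] -/
theorem finite_signedSelmerInfty_pTorsion_three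
    (h12 : Kobayashi2003.thm12_signedSelmerDual_finite_torsion)
    (h41 : Kobayashi2003.thm41_signedCharIdeal_divisibility)
    (h5 : realPeriodRat_eq_unit_mul_plusPeriod) (h3 : realPeriodRat_eq_unit_mul_plusPeriod_three)
    (hJ : Kobayashi2003.thm62_63_73_signedColemanKato_zetaJoint)
    (W : WeierstrassCurve ℚ) [W.IsElliptic] [W.IsGloballyMinimal]
    (hp3 : p = 3) (hgood : W.HasGoodReductionAtPrime p) (hap : W.frobeniusTrace p = 0) (hs : Surj W p)
    [NeZero (W.conductorNorm ℤ)] (f : CuspForm (Gamma0 (W.conductorNorm ℤ)) 2) (hf : IsNewformOf W f)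
    {κ : ZpExtension ℚ p} {γ : absoluteGaloisGroup ℚ} (hκ : κ.IsCyclotomic) (hγ : κ.IsTopGenerator γ)
    (hγc : IsCyclotomicVariable p γ) :
    ∃ ε : ℤˣ, Set.Finite {s : signedSelmerInfty W κ ε | p • s = 0} :=
  exists_sign_finite_signedSelmerInfty_pTorsion_of_muFloor h12 h41 h5 h3 hJ W
    (LargeImageMuFloor.signedMuFloor_three (W := W) p hp3 hgood hap) (by subst hp3; decide) hgood hap hs f hf hκ hγ hγc

end Summit.BirchSwinnertonDyer.BirchSwinnertonDyer.Theorems.LargeImageMuPartConjA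

end
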